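import Literature.AnabelianGeometry.SemiGraphs.ProSigmaCompletionSemidirectCofinal
import Literature.AnabelianGeometry.SemiGraphs.ProSigmaCompletionSemidirectDecomposition
import Literature.AnabelianGeometry.SemiGraphs.ProSigmaCompletionCyclicFreeProSigma
import Literature.AnabelianGeometry.AbsoluteAnabelian.FreeProcyclicModel
import HarnessLib

/-!
# Pro-`Σ` completion of `Δ ⋊_φ ℤ`, X: the retraction onto the completed section and its consequences

[SemiAnbd] Ex. 2.10 p. 31 (bib `MochizukiSemiAnbd2006`): the groups of a pointed stable curve over a log point
are maximal pro-`Σ` quotients; [AbsTopII] Def 1.2 (ii) p. 10 / Prop 1.3 (iii) p. 11 (bib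
`MochizukiAbsTopII2013`; kurims manuscript `paper:url-585b8d0ad0d9`): in the DPSC-extension
`1 → Π_𝔾 → Π_I → I → 1` the inertia `I ≅ Ẑ^Σ` and «`I_v ≅ I`», «`I_v ∩ Π_𝔾 = {1}`».

PROOF-ONLY file (abc-iut-f-066 gen 5, row «P13-TWO-VERTEX-NODAL-MODEL»; part X of the abc-iut-L3 /
f-066 `IsProSigmaCompletion` series, parts V/VIII/IX = `ProSigmaCompletionSemidirect{Cofinal,Decomposition}`).
Setting: `ι : Δ ⋊_φ ℤ → P` a pro-`Σ` completion with profinite `P`; `A := closure ι(inl Δ)` («`Π_𝔾`»),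
`T := closure ι(inr ℤ)` (the completed section, «`I ≅ Ẑ^Σ`», part VIII: a pro-`Σ` completion of `ℤ`).

* `exists_retraction` — **the continuous retraction `F : P → T`** extending `ι ∘ inr ∘ rightHom`
  (universal property of `ι` into the profinite pro-`Σ` group `T`): `F ∘ ι = ι ∘ inr ∘ rightHom`, `F|_T = id`
  (uniqueness of extensions along `ι ∘ inr`), `F(A) = 1`;
* `closure_inr_inf_closure_inl_eq_bot` — **`T ∩ A = {1}`**; `isFreeProSigmaCyclic_closure_inr` — **`T ≅ Ẑ^Σ`**
  (intrinsically); `exists_continuousMulEquiv_of_isCompl` / `isFreeProSigmaCyclic_of_isCompl` — every CLOSED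
  complement `S` of `A` (`S ∩ A = {1}`, `S · A = P`) is `≃ₜ* T`, hence `≅ Ẑ^Σ` («`I_v ≅ I`»);
* part XI (`ProSigmaCompletionSemidirectTwistedSections.lean`) treats the twisted sections `inl δ · inr 1`.

Classical profinite group theory; no side taken on [IUTchIII] Cor 3.12.
-/

namespace Literature.AnabelianGeometry.SemiGraphs.SemiGraphOfAnabelioids.IsProSigmaCompletion

open Literature.AnabelianGeometry.Anabelioids (IsSigmaInteger)
open Literature.AnabelianGeometry.AbsoluteAnabelian (AbsTopII.IsFreeProSigmaCyclic)
open Topology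
open scoped Pointwise

namespace SemidirectCofinal

variable {Δ : Type*} [Group Δ] {Sigma : Set ℕ} (φ : Multiplicative ℤ →* MulAut Δ)
variable {P : Type*} [Group P] [TopologicalSpace P] [IsTopologicalGroup P] [CompactSpace P] [T2Space P]
  [TotallyDisconnectedSpace P]

/-! ### The retraction `F : P → T` -/

/-- **The continuous retraction onto the completed section.**  For a pro-`Σ` completion `ι : Δ ⋊_φ ℤ → P`
(`P` profinite) there is a continuous homomorphism `F : P → T = closure ι(inr ℤ)` with
`F(ι x) = ι(inr (rightHom x))`, `F t = t` on `T`, and `F = 1` on `A = closure ι(inl Δ)`.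
[cite: MochizukiAbsTopII2013, Prop 1.3 (iii) p.11] [cite: MochizukiSemiAnbd2006, Ex. 2.10 p.31] -/
theorem exists_retraction {ι : (Δ ⋊[φ] Multiplicative ℤ) →* P} (hι : IsProSigmaCompletion Sigma ι) :
    ∃ F : P →* ↥((SemidirectProduct.inr : Multiplicative ℤ →* Δ ⋊[φ] Multiplicative ℤ).range.map ι).topologicalClosure,
      Continuous F ∧
      (∀ x, (F (ι x) : P) = ι (SemidirectProduct.inr (SemidirectProduct.rightHom x))) ∧
      (∀ (t : P) (ht : t ∈ ((SemidirectProduct.inr :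
          Multiplicative ℤ →* Δ ⋊[φ] Multiplicative ℤ).range.map ι).topologicalClosure), (F t : P) = t) ∧
      ∀ a ∈ ((SemidirectProduct.inl : Δ →* Δ ⋊[φ] Multiplicative ℤ).range.map ι).topologicalClosure, F a = 1 := by
  set T := ((SemidirectProduct.inr : Multiplicative ℤ →* Δ ⋊[φ] Multiplicative ℤ).range.map ι).topologicalClosure
    with hT
  haveI : CompactSpace T := isCompact_iff_compactSpace.mp (Subgroup.isClosed_topologicalClosure _).isCompact
  -- the completed section as a pro-`Σ` completion of `ℤ`
  set κ : Multiplicative ℤ →* T :=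
    ((Subgroup.inclusion (Subgroup.le_topologicalClosure
      ((SemidirectProduct.inr : Multiplicative ℤ →* Δ ⋊[φ] Multiplicative ℤ).range.map ι))).comp
      (ι.subgroupMap (SemidirectProduct.inr : Multiplicative ℤ →* Δ ⋊[φ] Multiplicative ℤ).range)).comp
      (MonoidHom.ofInjective (SemidirectProduct.inr_injective (φ := φ))).toMonoidHom with hκ_def
  have hκ : IsProSigmaCompletion Sigma κ := isProSigmaCompletion_closure_inr φ hι
  have hκv : ∀ n, (κ n : P) = ι (SemidirectProduct.inr n) := fun n => rfl
  obtain ⟨F, hFc, hFι⟩ := exists_continuous_extend_profinite hι hκ.index_open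
    (κ.comp (SemidirectProduct.rightHom (N := Δ) (G := Multiplicative ℤ) (φ := φ)))
  refine ⟨F, hFc, fun x => ?_, fun t ht => ?_, fun a ha => ?_⟩
  · rw [hFι, MonoidHom.comp_apply, hκv]
  · -- `F|_T = id`: both extend `κ` along `κ`
    have h := continuous_extend_profinite_unique hκ (F := F.comp T.subtype) (F' := MonoidHom.id T)
      (hFc.comp continuous_subtype_val) continuous_id fun n => by
        rw [MonoidHom.comp_apply, MonoidHom.id_apply, Subgroup.coe_subtype, hκv, hFι, MonoidHom.comp_apply,
          SemidirectProduct.rightHom_inr]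
    have := DFunLike.congr_fun h ⟨t, ht⟩
    rw [MonoidHom.comp_apply, MonoidHom.id_apply, Subgroup.coe_subtype] at this
    rw [this]
  · -- `F(A) = 1`: `F` kills `ι(inl Δ)` and its kernel is closed
    have hker : IsClosed (F.ker : Set P) := by
      rw [MonoidHom.coe_ker]
      exact isClosed_singleton.preimage hFc
    have hle : ((SemidirectProduct.inl : Δ →* Δ ⋊[φ] Multiplicative ℤ).range.map ι) ≤ F.ker := by
      rintro _ ⟨_, ⟨d, rfl⟩, rfl⟩
      rw [MonoidHom.mem_ker, hFι, MonoidHom.comp_apply, SemidirectProduct.rightHom_inl, map_one]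
    exact (Subgroup.topologicalClosure_minimal _ hle hker) ha

/-- **`T ∩ A = {1}`**: the completed section meets `Π_𝔾 = closure ι(inl Δ)` trivially («`I_v ∩ Π_𝔾 = {1}`»
at the model). [cite: MochizukiAbsTopII2013, Prop 1.3 (iii) p.11] -/
theorem closure_inr_inf_closure_inl_eq_bot {ι : (Δ ⋊[φ] Multiplicative ℤ) →* P}
    (hι : IsProSigmaCompletion Sigma ι) :
    ((SemidirectProduct.inr : Multiplicative ℤ →* Δ ⋊[φ] Multiplicative ℤ).range.map ι).topologicalClosure ⊓
      ((SemidirectProduct.inl : Δ →* Δ ⋊[φ] Multiplicative ℤ).range.map ι).topologicalClosure = ⊥ := by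
  obtain ⟨F, -, -, hFT, hFA⟩ := exists_retraction φ hι
  rw [eq_bot_iff]
  rintro x ⟨hxT, hxA⟩
  rw [Subgroup.mem_bot, ← hFT x hxT, hFA x hxA, Subgroup.coe_one]

omit [TotallyDisconnectedSpace P] in
/-- The kernel of the retraction is exactly `A = closure ι(inl Δ)` (`P = A · T`, `F|_T = id`).
[cite: MochizukiAbsTopII2013, Prop 1.3 (iii) p.11] -/
theorem retraction_eq_one_iff {ι : (Δ ⋊[φ] Multiplicative ℤ) →* P} (hι : IsProSigmaCompletion Sigma ι)
    {F : P →* ↥((SemidirectProduct.inr : Multiplicative ℤ →* Δ ⋊[φ] Multiplicative ℤ).range.map ι).topologicalClosure}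
    (hFT : ∀ (t : P) (ht : t ∈ ((SemidirectProduct.inr :
          Multiplicative ℤ →* Δ ⋊[φ] Multiplicative ℤ).range.map ι).topologicalClosure), (F t : P) = t)
    (hFA : ∀ a ∈ ((SemidirectProduct.inl : Δ →* Δ ⋊[φ] Multiplicative ℤ).range.map ι).topologicalClosure, F a = 1)
    (x : P) :
    F x = 1 ↔ x ∈ ((SemidirectProduct.inl : Δ →* Δ ⋊[φ] Multiplicative ℤ).range.map ι).topologicalClosure := by
  refine ⟨fun hx => ?_, hFA x⟩
  haveI := normal_closure_map_range_inl φ hι.dense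
  have htop := closure_inl_sup_closure_inr_eq_top φ (P := P) hι.dense
  have hx' : x ∈ (((SemidirectProduct.inl : Δ →* Δ ⋊[φ] Multiplicative ℤ).range.map ι).topologicalClosure ⊔
      ((SemidirectProduct.inr : Multiplicative ℤ →* Δ ⋊[φ] Multiplicative ℤ).range.map ι).topologicalClosure :
        Subgroup P) := by rw [htop]; exact Subgroup.mem_top x
  rw [← SetLike.mem_coe, Subgroup.normal_mul] at hx'
  obtain ⟨a, ha, t, ht, rfl⟩ := Set.mem_mul.mp hx'
  have : (F (a * t) : P) = t := by rw [map_mul, hFA a ha, one_mul, hFT t ht]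
  rw [hx, Subgroup.coe_one] at this
  rw [← this, mul_one]
  exact ha

/-- **`T ≅ Ẑ^Σ`**: the completed section is free pro-`Σ`-cyclic («`I ≅ Ẑ^Σ`»; part VIII + the cyclic
lemma). [cite: MochizukiAbsTopII2013, Prop 1.3 (iii) p.11] -/
theorem isFreeProSigmaCyclic_closure_inr {ι : (Δ ⋊[φ] Multiplicative ℤ) →* P}
    (hι : IsProSigmaCompletion Sigma ι) :
    AbsTopII.IsFreeProSigmaCyclic Sigma
      ↥((SemidirectProduct.inr : Multiplicative ℤ →* Δ ⋊[φ] Multiplicative ℤ).range.map ι).topologicalClosure :=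
  isFreeProSigmaCyclic_of_isProSigmaCompletion_int (isProSigmaCompletion_closure_inr φ hι)

/-- **Every closed complement of `A` is `≃ₜ* T`** («`I_v ⥲ I`»): if `S` is closed, `S ∩ A = {1}` and
`S · A = P`, the retraction restricts to an isomorphism of topological groups `S ≅ T`.
[cite: MochizukiAbsTopII2013, Prop 1.3 (iii) p.11] -/
theorem exists_continuousMulEquiv_of_isCompl {ι : (Δ ⋊[φ] Multiplicative ℤ) →* P}
    (hι : IsProSigmaCompletion Sigma ι) {S : Subgroup P} (hSc : IsClosed (S : Set P))
    (hinf : S ⊓ ((SemidirectProduct.inl : Δ →* Δ ⋊[φ] Multiplicative ℤ).range.map ι).topologicalClosure = ⊥)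
    (hsup : S ⊔ ((SemidirectProduct.inl : Δ →* Δ ⋊[φ] Multiplicative ℤ).range.map ι).topologicalClosure = ⊤) :
    Nonempty (↥S ≃ₜ*
      ↥((SemidirectProduct.inr : Multiplicative ℤ →* Δ ⋊[φ] Multiplicative ℤ).range.map ι).topologicalClosure) := by
  haveI := normal_closure_map_range_inl φ hι.dense
  haveI : CompactSpace S := isCompact_iff_compactSpace.mp hSc.isCompact
  obtain ⟨F, hFc, -, hFT, hFA⟩ := exists_retraction φ hι
  let f := F.comp S.subtype
  have hf : Function.Bijective f := by
    constructor
    · intro x y hxy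
      have h1 : F ((x : P) * (y : P)⁻¹) = 1 := by
        rw [map_mul, map_inv, mul_inv_eq_one]
        exact hxy
      have hmem := (retraction_eq_one_iff φ hι hFT hFA _).mp h1
      have hS : (x : P) * (y : P)⁻¹ ∈ S := S.mul_mem x.2 (S.inv_mem y.2)
      have : (x : P) * (y : P)⁻¹ = 1 := by
        rw [← Subgroup.mem_bot, ← hinf]
        exact ⟨hS, hmem⟩
      exact Subtype.ext (mul_inv_eq_one.mp this)
    · rintro ⟨t, ht⟩
      have ht' : t ∈ ((S ⊔ ((SemidirectProduct.inl : Δ →* Δ ⋊[φ] Multiplicative ℤ).range.map ι).topologicalClosure :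
          Subgroup P) : Set P) := by rw [hsup]; exact Subgroup.mem_top t
      rw [Subgroup.mul_normal] at ht'
      obtain ⟨s, hs, a, ha, rfl⟩ := Set.mem_mul.mp ht'
      refine ⟨⟨s, hs⟩, Subtype.ext ?_⟩
      change (F s : P) = s * a
      have := hFT (s * a) ht
      rw [map_mul, hFA a ha, mul_one] at this
      exact this
  have hfc : Continuous f := hFc.comp continuous_subtype_val
  let e := Equiv.ofBijective f hf
  let h : ↥S ≃ₜ _ := hfc.homeoOfEquivCompactToT2 (f := e)
  exact ⟨{ f with
    toFun := e, invFun := e.symm, left_inv := e.left_inv, right_inv := e.right_inv,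
    continuous_toFun := hfc, continuous_invFun := h.continuous_symm }⟩

/-- **Closed complements of `A` are free pro-`Σ`-cyclic** («`I_v ≅ I ≅ Ẑ^Σ`»).
[cite: MochizukiAbsTopII2013, Prop 1.3 (iii) p.11] -/
theorem isFreeProSigmaCyclic_of_isCompl {ι : (Δ ⋊[φ] Multiplicative ℤ) →* P}
    (hι : IsProSigmaCompletion Sigma ι) {S : Subgroup P} (hSc : IsClosed (S : Set P))
    (hinf : S ⊓ ((SemidirectProduct.inl : Δ →* Δ ⋊[φ] Multiplicative ℤ).range.map ι).topologicalClosure = ⊥)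
    (hsup : S ⊔ ((SemidirectProduct.inl : Δ →* Δ ⋊[φ] Multiplicative ℤ).range.map ι).topologicalClosure = ⊤) :
    AbsTopII.IsFreeProSigmaCyclic Sigma ↥S := by
  obtain ⟨e⟩ := exists_continuousMulEquiv_of_isCompl φ hι hSc hinf hsup
  exact (isFreeProSigmaCyclic_closure_inr φ hι).of_continuousMulEquiv e.symm

end SemidirectCofinal

end Literature.AnabelianGeometry.SemiGraphs.SemiGraphOfAnabelioids.IsProSigmaCompletion
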